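import Summits.Ventures.PercRepro.RankLevelSetDepCountGiantB2
import Summits.Ventures.PercRepro.RankLevelSetLevelSixArithGiantSA
import Summits.Ventures.PercRepro.RankLevelSetLevelSixArithGiantSB
import Summits.Ventures.PercRepro.RankLevelSetLevelSixArithGiantSC
import Summits.Ventures.PercRepro.RankLevelSetLevelSixArithGiantSD
import Summits.Ventures.PercRepro.RankLevelSetLevelSixArithGiantSE
import Summits.Ventures.PercRepro.RankLevelSetLevelSixArithGiantSF
import Summits.Ventures.PercRepro.RankLevelSetLevelSixArithGiantSG
import Summits.Ventures.PercRepro.RankLevelSetLevelSix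
import Summits.Ventures.PercRepro.S1FourCircuitCount
import Summits.Ventures.PercRepro.RankLevelSetPlaneSix
import Summits.Ventures.PercRepro.S1TriangleCount
import Summits.Ventures.PercRepro.RankLevelSetTriangleStar
import Summits.Ventures.PercRepro.RankLevelSetCorankFiveCounts
import Summits.Ventures.PercRepro.RankLevelSetPlaneTen
import Summits.Ventures.PercRepro.RankLevelSetCoreFour
import Summits.Ventures.PercRepro.RankLevelSetFrameLarge
import Summits.Ventures.PercRepro.RankLevelSetFrameQM
import Summits.Ventures.PercRepro.RankLevelSetLevelFiveAll
import Summits.Ventures.PercRepro.RankLevelSetLevelSixGiant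

/-!
# PercRepro — THE GIANT-FLAT COUNT, THE CORE CELLS AT CORANK `17 ≤ d ≤ 50` FROM `p ≥ 165` (p8, S3)

`proofs/SUBCLAIM-S3-p8.md` §3e. The three-class count of §3d (`ncard_eRk_eq_ncard_le_le_giant`) with the `(P_d)` row
re-proved at `p ≥ 165` (`level_six_poly_giantS_d`, `d = 17 … 48` in RankLevelSetLevelSixArithGiantSC … SG, `d = 49, 50`
here; dispatcher `level_six_poly_giantS`): `c025_core_six_bounded_corank_giantS_big (165 ≤ p) (17 ≤ d ≤ 50)`.
Axioms: standard.
-/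

open scoped Matroid

namespace PercRepro

set_option maxHeartbeats 400000 in
/-- `(P_49)` at level `6`, giant-flat count (`σ_small = 65535/16`, `σ_mid = 4294967295/32`, `σ_giant = 137438953471/37`), for every `p ≥ 165`. -/
theorem level_six_poly_giantS_49 (p : ℕ) (hp : 165 ≤ p) :
    8 * ((((p + 49).choose 6 : ℕ) : ℚ) + (∑ j ∈ Finset.range (49 - 7 + 1), ((Nat.choose (min 21 (5 + 49) - 6) j : ℕ) : ℚ) / ((j : ℚ) + 1)) *
      (((49 * (49 + 1) / 2 : ℕ) : ℚ) * ((p + 49).choose 4 : ℚ) + ((49 * (49 + 1) * (49 + 2) / 3 : ℕ) : ℚ) * ((p + 49).choose 3 : ℚ) + (((49 + 4).choose 5 : ℕ) : ℚ) * ((p + 49).choose 2 : ℚ) + (((49 + 5).choose 6 : ℕ) : ℚ) * ((p + 49 : ℕ) : ℚ) + (((49 + 6).choose 7 : ℕ) : ℚ)) +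
      (∑ j ∈ Finset.range (49 - 7 + 1), ((Nat.choose (min (min 43 (6 + 49) - 7) ((49 + 16) / 2 + 1 - 2)) j : ℕ) : ℚ) / ((j : ℚ) + 1)) *
      (((49 * (49 + 1) / 2 : ℕ) : ℚ) * ((7 * 49).choose 4 : ℚ) + ((49 * (49 + 1) * (49 + 2) / 3 : ℕ) : ℚ) * ((7 * 49).choose 3 : ℚ) + (((49 + 4).choose 5 : ℕ) : ℚ) * ((7 * 49).choose 2 : ℚ) + (((49 + 5).choose 6 : ℕ) : ℚ) * ((7 * 49 : ℕ) : ℚ) + (((49 + 6).choose 7 : ℕ) : ℚ)) +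
      (∑ j ∈ Finset.range (49 - 7 + 1), ((Nat.choose (min (min 43 (6 + 49)) (6 + 49) - 7) j : ℕ) : ℚ) / ((j : ℚ) + 1)) *
      (((49 * (49 + 1) / 2 : ℕ) : ℚ) * ((min (min 43 (6 + 49)) (6 + 49)).choose 4 : ℚ) + ((49 * (49 + 1) * (49 + 2) / 3 : ℕ) : ℚ) * ((min (min 43 (6 + 49)) (6 + 49)).choose 3 : ℚ) + (((49 + 4).choose 5 : ℕ) : ℚ) * ((min (min 43 (6 + 49)) (6 + 49)).choose 2 : ℚ) + (((49 + 5).choose 6 : ℕ) : ℚ) * ((min (min 43 (6 + 49)) (6 + 49) : ℕ) : ℚ) + (((49 + 6).choose 7 : ℕ) : ℚ))) ≤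
      7 * 2 ^ (49 - 6) * (((p + 6).choose 6 : ℕ) : ℚ) := by
  have hσs : (∑ j ∈ Finset.range (49 - 7 + 1), ((Nat.choose (min 21 (5 + 49) - 6) j : ℕ) : ℚ) / ((j : ℚ) + 1)) = (65535 / 16 : ℚ) := by
    norm_num [Finset.sum_range_succ, Nat.choose]
  have hσm : (∑ j ∈ Finset.range (49 - 7 + 1), ((Nat.choose (min (min 43 (6 + 49) - 7) ((49 + 16) / 2 + 1 - 2)) j : ℕ) : ℚ) / ((j : ℚ) + 1)) = (4294967295 / 32 : ℚ) := by
    norm_num [Finset.sum_range_succ, Nat.choose]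
  have hσg : (∑ j ∈ Finset.range (49 - 7 + 1), ((Nat.choose (min (min 43 (6 + 49)) (6 + 49) - 7) j : ℕ) : ℚ) / ((j : ℚ) + 1)) = (137438953471 / 37 : ℚ) := by
    norm_num [Finset.sum_range_succ, Nat.choose]
  have hbig : (((49 * (49 + 1) / 2 : ℕ) : ℚ) * ((7 * 49).choose 4 : ℚ) + ((49 * (49 + 1) * (49 + 2) / 3 : ℕ) : ℚ) * ((7 * 49).choose 3 : ℚ) + (((49 + 4).choose 5 : ℕ) : ℚ) * ((7 * 49).choose 2 : ℚ) + (((49 + 5).choose 6 : ℕ) : ℚ) * ((7 * 49 : ℕ) : ℚ) + (((49 + 6).choose 7 : ℕ) : ℚ)) = (1149243315150 : ℚ) := by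
    have hc2 := choose_two_mul (341)
    have hc3 := choose_three_mul (340)
    have hc4 := choose_four_mul (339)
    norm_num at hc2 hc3 hc4
    have hb2 : Nat.choose 343 2 = 58653 := by omega
    have hb3 : Nat.choose 343 3 = 6666891 := by omega
    have hb4 : Nat.choose 343 4 = 566685735 := by omega
    rw [show (7 * 49 : ℕ) = 343 from rfl, hb2, hb3, hb4]
    norm_num [Nat.choose]
  have hgiant : (((49 * (49 + 1) / 2 : ℕ) : ℚ) * ((min (min 43 (6 + 49)) (6 + 49)).choose 4 : ℚ) + ((49 * (49 + 1) * (49 + 2) / 3 : ℕ) : ℚ) * ((min (min 43 (6 + 49)) (6 + 49)).choose 3 : ℚ) + (((49 + 4).choose 5 : ℕ) : ℚ) * ((min (min 43 (6 + 49)) (6 + 49)).choose 2 : ℚ) + (((49 + 5).choose 6 : ℕ) : ℚ) * ((min (min 43 (6 + 49)) (6 + 49) : ℕ) : ℚ) + (((49 + 6).choose 7 : ℕ) : ℚ)) = (4570001275 : ℚ) := by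
    rw [show (min (min 43 (6 + 49)) (6 + 49) : ℕ) = 43 from rfl]
    norm_num [Nat.choose]
  have hs3 : ((49 * (49 + 1) / 2 : ℕ) : ℚ) = (1225 : ℚ) := by norm_num
  have hs4 : ((49 * (49 + 1) * (49 + 2) / 3 : ℕ) : ℚ) = (41650 : ℚ) := by norm_num
  have hs5 : (((49 + 4).choose 5 : ℕ) : ℚ) = (2869685 : ℚ) := by norm_num [Nat.choose]
  have hs6 : (((49 + 5).choose 6 : ℕ) : ℚ) = (25827165 : ℚ) := by norm_num [Nat.choose]
  have hs7 : (((49 + 6).choose 7 : ℕ) : ℚ) = (202927725 : ℚ) := by norm_num [Nat.choose]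
  rw [hσs, hσm, hσg, hbig, hgiant, hs3, hs4, hs5, hs6, hs7]
  obtain ⟨t, rfl⟩ : ∃ t, p = 165 + t := ⟨p - 165, by omega⟩
  have h1 : (720 : ℚ) * (((165 + t + 49).choose 6 : ℕ) : ℚ) = ((208 : ℚ) + t + 1) * ((208 : ℚ) + t + 2) * ((208 : ℚ) + t + 3) * ((208 : ℚ) + t + 4) * ((208 : ℚ) + t + 5) * ((208 : ℚ) + t + 6) := by
    have := choose_six_mul (208 + t)
    rw [show 165 + t + 49 = 208 + t + 6 by ring]
    exact_mod_cast this
  have h2 : (24 : ℚ) * (((165 + t + 49).choose 4 : ℕ) : ℚ) = ((210 : ℚ) + t + 1) * ((210 : ℚ) + t + 2) * ((210 : ℚ) + t + 3) * ((210 : ℚ) + t + 4) := by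
    have := choose_four_mul (210 + t)
    rw [show 165 + t + 49 = 210 + t + 4 by ring]
    exact_mod_cast this
  have h3 : (6 : ℚ) * (((165 + t + 49).choose 3 : ℕ) : ℚ) = ((211 : ℚ) + t + 1) * ((211 : ℚ) + t + 2) * ((211 : ℚ) + t + 3) := by
    have := choose_three_mul (211 + t)
    rw [show 165 + t + 49 = 211 + t + 3 by ring]
    exact_mod_cast this
  have h4 : (2 : ℚ) * (((165 + t + 49).choose 2 : ℕ) : ℚ) = ((212 : ℚ) + t + 1) * ((212 : ℚ) + t + 2) := by
    have := choose_two_mul (212 + t)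
    rw [show 165 + t + 49 = 212 + t + 2 by ring]
    exact_mod_cast this
  have h5 : (720 : ℚ) * (((165 + t + 6).choose 6 : ℕ) : ℚ) = ((165 : ℚ) + t + 1) * ((165 : ℚ) + t + 2) * ((165 : ℚ) + t + 3) * ((165 : ℚ) + t + 4) * ((165 : ℚ) + t + 5) * ((165 : ℚ) + t + 6) := by
    have := choose_six_mul (165 + t)
    exact_mod_cast this
  push_cast
  nlinarith [h1, h2, h3, h4, h5, pow_nonneg (Nat.cast_nonneg t : (0 : ℚ) ≤ t) 1, pow_nonneg (Nat.cast_nonneg t : (0 : ℚ) ≤ t) 2, pow_nonneg (Nat.cast_nonneg t : (0 : ℚ) ≤ t) 3, pow_nonneg (Nat.cast_nonneg t : (0 : ℚ) ≤ t) 4, pow_nonneg (Nat.cast_nonneg t : (0 : ℚ) ≤ t) 5, pow_nonneg (Nat.cast_nonneg t : (0 : ℚ) ≤ t) 6]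

set_option maxHeartbeats 400000 in
/-- `(P_50)` at level `6`, giant-flat count (`σ_small = 65535/16`, `σ_mid = 8589934591/33`, `σ_giant = 137438953471/37`), for every `p ≥ 165`. -/
theorem level_six_poly_giantS_50 (p : ℕ) (hp : 165 ≤ p) :
    8 * ((((p + 50).choose 6 : ℕ) : ℚ) + (∑ j ∈ Finset.range (50 - 7 + 1), ((Nat.choose (min 21 (5 + 50) - 6) j : ℕ) : ℚ) / ((j : ℚ) + 1)) *
      (((50 * (50 + 1) / 2 : ℕ) : ℚ) * ((p + 50).choose 4 : ℚ) + ((50 * (50 + 1) * (50 + 2) / 3 : ℕ) : ℚ) * ((p + 50).choose 3 : ℚ) + (((50 + 4).choose 5 : ℕ) : ℚ) * ((p + 50).choose 2 : ℚ) + (((50 + 5).choose 6 : ℕ) : ℚ) * ((p + 50 : ℕ) : ℚ) + (((50 + 6).choose 7 : ℕ) : ℚ)) +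
      (∑ j ∈ Finset.range (50 - 7 + 1), ((Nat.choose (min (min 43 (6 + 50) - 7) ((50 + 16) / 2 + 1 - 2)) j : ℕ) : ℚ) / ((j : ℚ) + 1)) *
      (((50 * (50 + 1) / 2 : ℕ) : ℚ) * ((7 * 50).choose 4 : ℚ) + ((50 * (50 + 1) * (50 + 2) / 3 : ℕ) : ℚ) * ((7 * 50).choose 3 : ℚ) + (((50 + 4).choose 5 : ℕ) : ℚ) * ((7 * 50).choose 2 : ℚ) + (((50 + 5).choose 6 : ℕ) : ℚ) * ((7 * 50 : ℕ) : ℚ) + (((50 + 6).choose 7 : ℕ) : ℚ)) +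
      (∑ j ∈ Finset.range (50 - 7 + 1), ((Nat.choose (min (min 43 (6 + 50)) (6 + 50) - 7) j : ℕ) : ℚ) / ((j : ℚ) + 1)) *
      (((50 * (50 + 1) / 2 : ℕ) : ℚ) * ((min (min 43 (6 + 50)) (6 + 50)).choose 4 : ℚ) + ((50 * (50 + 1) * (50 + 2) / 3 : ℕ) : ℚ) * ((min (min 43 (6 + 50)) (6 + 50)).choose 3 : ℚ) + (((50 + 4).choose 5 : ℕ) : ℚ) * ((min (min 43 (6 + 50)) (6 + 50)).choose 2 : ℚ) + (((50 + 5).choose 6 : ℕ) : ℚ) * ((min (min 43 (6 + 50)) (6 + 50) : ℕ) : ℚ) + (((50 + 6).choose 7 : ℕ) : ℚ))) ≤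
      7 * 2 ^ (50 - 6) * (((p + 6).choose 6 : ℕ) : ℚ) := by
  have hσs : (∑ j ∈ Finset.range (50 - 7 + 1), ((Nat.choose (min 21 (5 + 50) - 6) j : ℕ) : ℚ) / ((j : ℚ) + 1)) = (65535 / 16 : ℚ) := by
    norm_num [Finset.sum_range_succ, Nat.choose]
  have hσm : (∑ j ∈ Finset.range (50 - 7 + 1), ((Nat.choose (min (min 43 (6 + 50) - 7) ((50 + 16) / 2 + 1 - 2)) j : ℕ) : ℚ) / ((j : ℚ) + 1)) = (8589934591 / 33 : ℚ) := by
    norm_num [Finset.sum_range_succ, Nat.choose]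
  have hσg : (∑ j ∈ Finset.range (50 - 7 + 1), ((Nat.choose (min (min 43 (6 + 50)) (6 + 50) - 7) j : ℕ) : ℚ) / ((j : ℚ) + 1)) = (137438953471 / 37 : ℚ) := by
    norm_num [Finset.sum_range_succ, Nat.choose]
  have hbig : (((50 * (50 + 1) / 2 : ℕ) : ℚ) * ((7 * 50).choose 4 : ℚ) + ((50 * (50 + 1) * (50 + 2) / 3 : ℕ) : ℚ) * ((7 * 50).choose 3 : ℚ) + (((50 + 4).choose 5 : ℕ) : ℚ) * ((7 * 50).choose 2 : ℚ) + (((50 + 5).choose 6 : ℕ) : ℚ) * ((7 * 50 : ℕ) : ℚ) + (((50 + 6).choose 7 : ℕ) : ℚ)) = (1300284441275 : ℚ) := by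
    have hc2 := choose_two_mul (348)
    have hc3 := choose_three_mul (347)
    have hc4 := choose_four_mul (346)
    norm_num at hc2 hc3 hc4
    have hb2 : Nat.choose 350 2 = 61075 := by omega
    have hb3 : Nat.choose 350 3 = 7084700 := by omega
    have hb4 : Nat.choose 350 4 = 614597725 := by omega
    rw [show (7 * 50 : ℕ) = 350 from rfl, hb2, hb3, hb4]
    norm_num [Nat.choose]
  have hgiant : (((50 * (50 + 1) / 2 : ℕ) : ℚ) * ((min (min 43 (6 + 50)) (6 + 50)).choose 4 : ℚ) + ((50 * (50 + 1) * (50 + 2) / 3 : ℕ) : ℚ) * ((min (min 43 (6 + 50)) (6 + 50)).choose 3 : ℚ) + (((50 + 4).choose 5 : ℕ) : ℚ) * ((min (min 43 (6 + 50)) (6 + 50)).choose 2 : ℚ) + (((50 + 5).choose 6 : ℕ) : ℚ) * ((min (min 43 (6 + 50)) (6 + 50) : ℕ) : ℚ) + (((50 + 6).choose 7 : ℕ) : ℚ)) = (5037039905 : ℚ) := by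
    rw [show (min (min 43 (6 + 50)) (6 + 50) : ℕ) = 43 from rfl]
    norm_num [Nat.choose]
  have hs3 : ((50 * (50 + 1) / 2 : ℕ) : ℚ) = (1275 : ℚ) := by norm_num
  have hs4 : ((50 * (50 + 1) * (50 + 2) / 3 : ℕ) : ℚ) = (44200 : ℚ) := by norm_num
  have hs5 : (((50 + 4).choose 5 : ℕ) : ℚ) = (3162510 : ℚ) := by norm_num [Nat.choose]
  have hs6 : (((50 + 5).choose 6 : ℕ) : ℚ) = (28989675 : ℚ) := by norm_num [Nat.choose]
  have hs7 : (((50 + 6).choose 7 : ℕ) : ℚ) = (231917400 : ℚ) := by norm_num [Nat.choose]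
  rw [hσs, hσm, hσg, hbig, hgiant, hs3, hs4, hs5, hs6, hs7]
  obtain ⟨t, rfl⟩ : ∃ t, p = 165 + t := ⟨p - 165, by omega⟩
  have h1 : (720 : ℚ) * (((165 + t + 50).choose 6 : ℕ) : ℚ) = ((209 : ℚ) + t + 1) * ((209 : ℚ) + t + 2) * ((209 : ℚ) + t + 3) * ((209 : ℚ) + t + 4) * ((209 : ℚ) + t + 5) * ((209 : ℚ) + t + 6) := by
    have := choose_six_mul (209 + t)
    rw [show 165 + t + 50 = 209 + t + 6 by ring]
    exact_mod_cast this
  have h2 : (24 : ℚ) * (((165 + t + 50).choose 4 : ℕ) : ℚ) = ((211 : ℚ) + t + 1) * ((211 : ℚ) + t + 2) * ((211 : ℚ) + t + 3) * ((211 : ℚ) + t + 4) := by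
    have := choose_four_mul (211 + t)
    rw [show 165 + t + 50 = 211 + t + 4 by ring]
    exact_mod_cast this
  have h3 : (6 : ℚ) * (((165 + t + 50).choose 3 : ℕ) : ℚ) = ((212 : ℚ) + t + 1) * ((212 : ℚ) + t + 2) * ((212 : ℚ) + t + 3) := by
    have := choose_three_mul (212 + t)
    rw [show 165 + t + 50 = 212 + t + 3 by ring]
    exact_mod_cast this
  have h4 : (2 : ℚ) * (((165 + t + 50).choose 2 : ℕ) : ℚ) = ((213 : ℚ) + t + 1) * ((213 : ℚ) + t + 2) := by
    have := choose_two_mul (213 + t)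
    rw [show 165 + t + 50 = 213 + t + 2 by ring]
    exact_mod_cast this
  have h5 : (720 : ℚ) * (((165 + t + 6).choose 6 : ℕ) : ℚ) = ((165 : ℚ) + t + 1) * ((165 : ℚ) + t + 2) * ((165 : ℚ) + t + 3) * ((165 : ℚ) + t + 4) * ((165 : ℚ) + t + 5) * ((165 : ℚ) + t + 6) := by
    have := choose_six_mul (165 + t)
    exact_mod_cast this
  push_cast
  nlinarith [h1, h2, h3, h4, h5, pow_nonneg (Nat.cast_nonneg t : (0 : ℚ) ≤ t) 1, pow_nonneg (Nat.cast_nonneg t : (0 : ℚ) ≤ t) 2, pow_nonneg (Nat.cast_nonneg t : (0 : ℚ) ≤ t) 3, pow_nonneg (Nat.cast_nonneg t : (0 : ℚ) ≤ t) 4, pow_nonneg (Nat.cast_nonneg t : (0 : ℚ) ≤ t) 5, pow_nonneg (Nat.cast_nonneg t : (0 : ℚ) ≤ t) 6]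

/-- **`(P_d)` at level `6`, giant-flat count, every corank `17 ≤ d ≤ 50`, every `p ≥ 165`.** -/
theorem level_six_poly_giantS (d : ℕ) (hd1 : 17 ≤ d) (hd2 : d ≤ 50) (p : ℕ) (hp : 165 ≤ p) :
    8 * ((((p + d).choose 6 : ℕ) : ℚ) + (∑ j ∈ Finset.range (d - 7 + 1), ((Nat.choose (min 21 (5 + d) - 6) j : ℕ) : ℚ) / ((j : ℚ) + 1)) *
      (((d * (d + 1) / 2 : ℕ) : ℚ) * ((p + d).choose 4 : ℚ) + ((d * (d + 1) * (d + 2) / 3 : ℕ) : ℚ) * ((p + d).choose 3 : ℚ) + (((d + 4).choose 5 : ℕ) : ℚ) * ((p + d).choose 2 : ℚ) + (((d + 5).choose 6 : ℕ) : ℚ) * ((p + d : ℕ) : ℚ) + (((d + 6).choose 7 : ℕ) : ℚ)) +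
      (∑ j ∈ Finset.range (d - 7 + 1), ((Nat.choose (min (min 43 (6 + d) - 7) ((d + 16) / 2 + 1 - 2)) j : ℕ) : ℚ) / ((j : ℚ) + 1)) *
      (((d * (d + 1) / 2 : ℕ) : ℚ) * ((7 * d).choose 4 : ℚ) + ((d * (d + 1) * (d + 2) / 3 : ℕ) : ℚ) * ((7 * d).choose 3 : ℚ) + (((d + 4).choose 5 : ℕ) : ℚ) * ((7 * d).choose 2 : ℚ) + (((d + 5).choose 6 : ℕ) : ℚ) * ((7 * d : ℕ) : ℚ) + (((d + 6).choose 7 : ℕ) : ℚ)) +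
      (∑ j ∈ Finset.range (d - 7 + 1), ((Nat.choose (min (min 43 (6 + d)) (6 + d) - 7) j : ℕ) : ℚ) / ((j : ℚ) + 1)) *
      (((d * (d + 1) / 2 : ℕ) : ℚ) * ((min (min 43 (6 + d)) (6 + d)).choose 4 : ℚ) + ((d * (d + 1) * (d + 2) / 3 : ℕ) : ℚ) * ((min (min 43 (6 + d)) (6 + d)).choose 3 : ℚ) + (((d + 4).choose 5 : ℕ) : ℚ) * ((min (min 43 (6 + d)) (6 + d)).choose 2 : ℚ) + (((d + 5).choose 6 : ℕ) : ℚ) * ((min (min 43 (6 + d)) (6 + d) : ℕ) : ℚ) + (((d + 6).choose 7 : ℕ) : ℚ))) ≤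
      7 * 2 ^ (d - 6) * (((p + 6).choose 6 : ℕ) : ℚ) := by
  interval_cases d
  · exact level_six_poly_giantS_17 p hp
  · exact level_six_poly_giantS_18 p hp
  · exact level_six_poly_giantS_19 p hp
  · exact level_six_poly_giantS_20 p hp
  · exact level_six_poly_giantS_21 p hp
  · exact level_six_poly_giantS_22 p hp
  · exact level_six_poly_giantS_23 p hp
  · exact level_six_poly_giantS_24 p hp
  · exact level_six_poly_giantS_25 p hp
  · exact level_six_poly_giantS_26 p hp
  · exact level_six_poly_giantS_27 p hp
  · exact level_six_poly_giantS_28 p hp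
  · exact level_six_poly_giantS_29 p hp
  · exact level_six_poly_giantS_30 p hp
  · exact level_six_poly_giantS_31 p hp
  · exact level_six_poly_giantS_32 p hp
  · exact level_six_poly_giantS_33 p hp
  · exact level_six_poly_giantS_34 p hp
  · exact level_six_poly_giantS_35 p hp
  · exact level_six_poly_giantS_36 p hp
  · exact level_six_poly_giantS_37 p hp
  · exact level_six_poly_giantS_38 p hp
  · exact level_six_poly_giantS_39 p hp
  · exact level_six_poly_giantS_40 p hp
  · exact level_six_poly_giantS_41 p hp
  · exact level_six_poly_giantS_42 p hp
  · exact level_six_poly_giantS_43 p hp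
  · exact level_six_poly_giantS_44 p hp
  · exact level_six_poly_giantS_45 p hp
  · exact level_six_poly_giantS_46 p hp
  · exact level_six_poly_giantS_47 p hp
  · exact level_six_poly_giantS_48 p hp
  · exact level_six_poly_giantS_49 p hp
  · exact level_six_poly_giantS_50 p hp

namespace ThmN

open Set

variable {α : Type}

/-- **The `e`-free core at level `6`, corank `17 ≤ d ≤ 50`, rank `p ≥ 165`** — the three-class count at the unique
giant flat, with the `(P_d)` row at `165`. -/
theorem c025_core_six_bounded_corank_giantS_big (M : Matroid α) [M.Finite] (p d : ℕ) (hp : 165 ≤ p) (hd17 : 17 ≤ d)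
    (hd50 : d ≤ 50) (hR : M.eRank = (p : ℕ∞)) (hn : M.E.ncard = p + d)
    (hfree : ∀ e ∈ M.E, ∃ A ⊆ M.E \ {e}, e ∉ M.closure A ∧ e ∉ M.closure ((M.E \ {e}) \ A)) :
    RLS M p 6 := by
  classical
  have hEcard : M.ground_finite.toFinset.card = p + d := by
    rw [← Set.ncard_eq_toFinset_card _ M.ground_finite]; exact hn
  -- the core is simple: every circuit has `≥ 3` elements
  have hL : ∀ e ∈ M.E, ¬ M.IsLoop e := not_isLoop_of_free M hfree
  have hs : ∀ e ∈ M.E, ∀ f ∈ M.E, e ≠ f → M.eRk {e, f} = 2 := by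
    intro e he f hf hef
    have h2 : (2 : ℕ∞) ≤ M.eRk {e, f} :=
      two_le_eRk_of_two_le_ncard_of_free M hfree (pair_subset he hf) (by rw [ncard_pair hef])
    have h3 : M.eRk {e, f} ≤ 2 := by
      have := M.eRk_le_encard {e, f}
      rwa [encard_pair hef] at this
    exact le_antisymm h3 h2
  have hcirc : ∀ C, M.IsCircuit C → 3 ≤ C.encard := three_le_encard_of_circuit M hL hs
  -- rank-`≤ 6` sets have `≤ 43` points
  have hd : M.E.encard = M.eRank + d := by
    rw [hR, ← M.ground_finite.cast_ncard_eq, hn]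
    push_cast
    ring
  -- the nullity cap: every `X ⊆ E` has `|X| ≤ r(X) + d`
  have hcap : ∀ X ⊆ M.E, ∀ k : ℕ, M.eRk X ≤ k → X.ncard ≤ k + d := by
    intro X hX k hr
    have h1 := Matroid.encard_le_eRk_add_of_encard_eq hX hd
    have h2 : X.encard ≤ (k : ℕ∞) + d := h1.trans (by gcongr)
    have hfin : X.Finite := M.ground_finite.subset hX
    rw [← hfin.cast_ncard_eq] at h2
    exact_mod_cast h2
  have hflat : ∀ X ⊆ M.E, M.eRk X ≤ 6 → X.ncard ≤ min 43 (6 + d) :=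
    fun X hX hr => le_min (ncard_le_fortythree_of_eRk_le_six_of_free M hfree hX hr) (hcap X hX 6 hr)
  -- (U)
  have hflat' : ∀ X ⊆ M.E, M.eRk X ≤ ((6 - 1 : ℕ) : ℕ∞) → X.ncard ≤ min 21 (5 + d) :=
    fun X hX hr => le_min (ncard_le_twentyone_of_eRk_le_five_of_free M hfree hX (by simpa using hr))
      (hcap X hX 5 (by simpa using hr))
  have hU1 := Matroid.topCount_le_ncard_compl (M := M) hR hd 6
  -- the nullity bound `ν_∩ = 16` on rank-`≤ 5` sets of the core
  have hinter : ∀ X ⊆ M.E, M.eRk X ≤ ((6 - 1 : ℕ) : ℕ∞) → (X.ncard : ℕ∞) ≤ M.eRk X + 16 := by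
    intro X hX hr
    obtain ⟨r, hrX⟩ := Matroid.exists_eRk_eq_nat (M := M) hX
    rw [hrX] at hr ⊢
    have hr5 : r ≤ 5 := by exact_mod_cast hr
    have hbound : X.ncard ≤ r + 16 := by
      rcases Nat.lt_or_ge r 4 with h4 | h4
      · have := ncard_add_one_le_two_pow_of_eRk_le M hL hfree r X hX (by rw [hrX])
        interval_cases r <;> omega
      · rcases Nat.lt_or_ge r 5 with h5 | h5
        · have hr4 : r = 4 := by omega
          have := ncard_le_ten_of_eRk_le_four_of_free M hfree hX (by rw [hrX, hr4]; norm_num)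
          omega
        · have hr5' : r = 5 := by omega
          have := ncard_le_twentyone_of_eRk_le_five_of_free M hfree hX (by rw [hrX, hr5']; norm_num)
          omega
    exact_mod_cast hbound
  have h2ν : d + 16 < 2 * ((d + 16) / 2 + 1) := by omega
  have hG := Matroid.ncard_eRk_eq_ncard_le_le_giant M 6 (min 43 (6 + d)) (min 21 (5 + d)) ((d + 16) / 2 + 1) 16
    (by norm_num) hcirc hflat hflat' hinter hd h2ν
  simp only [show (6 : ℕ) + 1 = 7 from rfl] at hG
  rw [hn, sum_Icc_three_seven_q, sum_Icc_three_seven_q, sum_Icc_three_seven_q] at hG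
  simp only [show (7 : ℕ) - 3 = 4 from rfl, show (7 : ℕ) - 4 = 3 from rfl, show (7 : ℕ) - 5 = 2 from rfl,
    show (7 : ℕ) - 6 = 1 from rfl, show (7 : ℕ) - 7 = 0 from rfl, Nat.choose_one_right, Nat.choose_zero_right,
    mul_one, Nat.cast_one] at hG
  have hC1 : ∀ L ⊆ M.E, M.eRk L = 2 → L.ncard ≤ 3 :=
    fun L hL hr => ncard_le_three_of_eRk_two M hs hfree hL hr
  have hs3 : {C | M.IsCircuit C ∧ C.ncard = 3}.ncard ≤ d * (d + 1) / 2 := by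
    have hT : 2 * {C | M.IsCircuit C ∧ C.ncard = 3}.ncard ≤ d * (d + 1) := S1.two_mul_ncard_triangles_le M hC1 hd
    omega
  have hC2 : ∀ P ⊆ M.E, M.eRk P ≤ 3 → P.ncard ≤ 6 :=
    fun P hP hr => ncard_le_six_of_eRk_le_three_of_free M hfree hP hr
  have hC1' : ∀ L ⊆ M.E, M.eRk L ≤ 2 → L.ncard ≤ 3 := by
    intro L hL' hr
    have := ncard_add_one_le_two_pow_of_eRk_le M hL hfree 2 L hL' hr
    omega
  have hs4 : {C | M.IsCircuit C ∧ C.ncard = 4}.ncard ≤ d * (d + 1) * (d + 2) / 3 := by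
    have hT4 : 3 * {C : Set α | M.IsCircuit C ∧ C.ncard = 4}.ncard ≤ d * (d + 1) * (d + 2) :=
      S1.three_mul_ncard_four_circuits_le M hC1' hC2 hd
    omega
  have hs5 : {C | M.IsCircuit C ∧ C.ncard = 5}.ncard ≤ (d + 4).choose 5 :=
    Matroid.ncard_circuits_le_choose_of_encard M hd 4
  have hs6 : {C | M.IsCircuit C ∧ C.ncard = 6}.ncard ≤ (d + 5).choose 6 :=
    Matroid.ncard_circuits_le_choose_of_encard M hd 5
  have hs7 : {C | M.IsCircuit C ∧ C.ncard = 7}.ncard ≤ (d + 6).choose 7 :=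
    Matroid.ncard_circuits_le_choose_of_encard M hd 6
  have hs3q : ({C | M.IsCircuit C ∧ C.ncard = 3}.ncard : ℚ) ≤ ((d * (d + 1) / 2 : ℕ) : ℚ) := by exact_mod_cast hs3
  have hs4q : ({C | M.IsCircuit C ∧ C.ncard = 4}.ncard : ℚ) ≤ ((d * (d + 1) * (d + 2) / 3 : ℕ) : ℚ) := by
    exact_mod_cast hs4
  have hs5q : ({C | M.IsCircuit C ∧ C.ncard = 5}.ncard : ℚ) ≤ (((d + 4).choose 5 : ℕ) : ℚ) := by exact_mod_cast hs5
  have hs6q : ({C | M.IsCircuit C ∧ C.ncard = 6}.ncard : ℚ) ≤ (((d + 5).choose 6 : ℕ) : ℚ) := by exact_mod_cast hs6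
  have hs7q : ({C | M.IsCircuit C ∧ C.ncard = 7}.ncard : ℚ) ≤ (((d + 6).choose 7 : ℕ) : ℚ) := by exact_mod_cast hs7
  have hUq : (Matroid.topCount M p 6 : ℚ) ≤ ((p + d).choose 6 : ℚ) +
      (((∑ j ∈ Finset.range (d - 7 + 1), ((Nat.choose (min 21 (5 + d) - 6) j : ℕ) : ℚ) / ((j : ℚ) + 1)) *
        (((d * (d + 1) / 2 : ℕ) : ℚ) * ((p + d).choose 4 : ℚ) + ((d * (d + 1) * (d + 2) / 3 : ℕ) : ℚ) * ((p + d).choose 3 : ℚ) +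
          (((d + 4).choose 5 : ℕ) : ℚ) * ((p + d).choose 2 : ℚ) + (((d + 5).choose 6 : ℕ) : ℚ) * ((p + d : ℕ) : ℚ) +
          (((d + 6).choose 7 : ℕ) : ℚ)) +
      ((∑ j ∈ Finset.range (d - 7 + 1), ((Nat.choose (min (min 43 (6 + d) - 7) ((d + 16) / 2 + 1 - 2)) j : ℕ) : ℚ) / ((j : ℚ) + 1)) *
        (((d * (d + 1) / 2 : ℕ) : ℚ) * ((7 * d).choose 4 : ℚ) + ((d * (d + 1) * (d + 2) / 3 : ℕ) : ℚ) * ((7 * d).choose 3 : ℚ) +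
          (((d + 4).choose 5 : ℕ) : ℚ) * ((7 * d).choose 2 : ℚ) + (((d + 5).choose 6 : ℕ) : ℚ) * ((7 * d : ℕ) : ℚ) +
          (((d + 6).choose 7 : ℕ) : ℚ)) +
      (∑ j ∈ Finset.range (d - 7 + 1), ((Nat.choose (min (min 43 (6 + d)) (6 + d) - 7) j : ℕ) : ℚ) / ((j : ℚ) + 1)) *
        (((d * (d + 1) / 2 : ℕ) : ℚ) * ((min (min 43 (6 + d)) (6 + d)).choose 4 : ℚ) +
          ((d * (d + 1) * (d + 2) / 3 : ℕ) : ℚ) * ((min (min 43 (6 + d)) (6 + d)).choose 3 : ℚ) +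
          (((d + 4).choose 5 : ℕ) : ℚ) * ((min (min 43 (6 + d)) (6 + d)).choose 2 : ℚ) +
          (((d + 5).choose 6 : ℕ) : ℚ) * ((min (min 43 (6 + d)) (6 + d) : ℕ) : ℚ) +
          (((d + 6).choose 7 : ℕ) : ℚ))))) := by
    have h1 : (Matroid.topCount M p 6 : ℚ) ≤
        ({B : Set α | B ⊆ M.E ∧ M.eRk B = 6 ∧ B.ncard ≤ d}.ncard : ℚ) := by exact_mod_cast hU1
    rw [add_assoc, add_assoc] at hG
    refine h1.trans (hG.trans ?_)
    have hσs0 : (0 : ℚ) ≤ ∑ j ∈ Finset.range (d - 7 + 1), ((Nat.choose (min 21 (5 + d) - 6) j : ℕ) : ℚ) / ((j : ℚ) + 1) :=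
      Finset.sum_nonneg (fun j _ => by positivity)
    have hσm0 : (0 : ℚ) ≤ ∑ j ∈ Finset.range (d - 7 + 1),
        ((Nat.choose (min (min 43 (6 + d) - 7) ((d + 16) / 2 + 1 - 2)) j : ℕ) : ℚ) / ((j : ℚ) + 1) :=
      Finset.sum_nonneg (fun j _ => by positivity)
    have hσg0 : (0 : ℚ) ≤ ∑ j ∈ Finset.range (d - 7 + 1),
        ((Nat.choose (min (min 43 (6 + d)) (6 + d) - 7) j : ℕ) : ℚ) / ((j : ℚ) + 1) :=
      Finset.sum_nonneg (fun j _ => by positivity)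
    gcongr
  -- (Y)
  have hY := Matroid.two_pow_le_midCount_add (M := M) p 6 hR
  have hA : {X : Set α | X ⊆ M.E ∧ M.eRk X ≤ 6}.ncard ≤ ∑ j ∈ Finset.range (43 + 1), (p + d).choose j := by
    calc {X : Set α | X ⊆ M.E ∧ M.eRk X ≤ 6}.ncard
        ≤ {X : Set α | X ⊆ (M.ground_finite.toFinset : Set α) ∧ X.ncard ≤ 43}.ncard := by
          apply ncard_le_ncard
          · intro X hX
            exact ⟨by rw [Set.Finite.coe_toFinset]; exact hX.1, (hflat X hX.1 hX.2).trans (min_le_left _ _)⟩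
          · exact (Finset.finite_toSet _).finite_subsets.subset (fun X hX => hX.1)
      _ ≤ ∑ j ∈ Finset.range (43 + 1), M.ground_finite.toFinset.card.choose j :=
          ncard_subsets_ncard_le _ 43
      _ = ∑ j ∈ Finset.range (43 + 1), (p + d).choose j := by rw [hEcard]
  have hB := Matroid.ncard_spanning_le (M := M) hd
  rw [hEcard] at hY hB
  -- the tails
  have hT : 16 * ∑ j ∈ Finset.range 51, (p + d).choose j ≤ 2 ^ (p + d) :=
    sixteen_mul_sum_choose_le_fifty (p + d) (by omega)
  have hA' : ∑ j ∈ Finset.range (43 + 1), (p + d).choose j ≤ ∑ j ∈ Finset.range 51, (p + d).choose j :=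
    Finset.sum_le_sum_of_subset_of_nonneg (Finset.range_mono (by norm_num)) (fun _ _ _ => Nat.zero_le _)
  have hB' : ∑ j ∈ Finset.range (d + 1), (p + d).choose j ≤ ∑ j ∈ Finset.range 51, (p + d).choose j :=
    Finset.sum_le_sum_of_subset_of_nonneg (Finset.range_mono (by omega)) (fun _ _ _ => Nat.zero_le _)
  have hAB : 8 * ({X : Set α | X ⊆ M.E ∧ M.eRk X ≤ 6}.ncard +
      {X : Set α | X ⊆ M.E ∧ M.eRk X = M.eRank}.ncard) ≤ 2 ^ (p + d) := by
    have h1 := hA.trans hA'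
    have h2 := hB.trans hB'
    omega
  -- (Φ) and the polynomial inequality
  have hΦ := phiK_le_two_pow_div p 6
  rw [Nat.choose_symm_add] at hΦ
  have hpolyq := level_six_poly_giantS d hd17 hd50 p hp
  rw [add_assoc, add_assoc] at hpolyq
  -- assemble in `ℚ`
  rw [RLS_iff]
  have hYq : (2 : ℚ) ^ (p + d) ≤ (Matroid.midCount M p 6 : ℚ) +
      ({X : Set α | X ⊆ M.E ∧ M.eRk X ≤ 6}.ncard : ℚ) +
      ({X : Set α | X ⊆ M.E ∧ M.eRk X = M.eRank}.ncard : ℚ) := by exact_mod_cast hY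
  have hABq : 8 * (({X : Set α | X ⊆ M.E ∧ M.eRk X ≤ 6}.ncard : ℚ) +
      ({X : Set α | X ⊆ M.E ∧ M.eRk X = M.eRank}.ncard : ℚ)) ≤ 2 ^ (p + d) := by exact_mod_cast hAB
  have hU0 : (0 : ℚ) ≤ (Matroid.topCount M p 6 : ℚ) := Nat.cast_nonneg _
  have hd6 : 6 ≤ d := by omega
  exact level_arith (p := p) (d := d) (n := p + d) (q := 6) rfl hd6 hΦ hU0 hUq hYq hABq hpolyq

end ThmN

end PercRepro
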